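import Summits.ABC.ABC.Theorems.PlatonicClosureCoreTransport
import HarnessLib

/-!
# PlatonicClosureCoreOctahedral — part 2/6 of the ROUTE-INDEPENDENT node kernel `PlatonicClosureCore` (door J, second layer; lens-1 gen 7)

Source: lens-1 g7 ROUTE-INDEPENDENT landing variant `pkg/PlatonicClosureTheorems.lean` (cell `decomp-abc`; sha256
`f8bb28f6c96ac600…`; = node file `PlatonicClosure.lean` v2.2 with the three `Theses.RootDecompJ/B/G` imports replaced
by seven inline TREE TEXTS §T, writer recipe decomp-abc STATUS l.502; lens `lean check` rc 0 · 0 sorry · axioms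
standard; critic PRE-CLEARED l.513, bridge test `Iff.rfl` ×7 against J rev 3 / B rev 7 / G rev 6 rc 0).

This module: §4 (forms) Klein's octahedral edge form `tO`, the syzygy `klein_octahedral`, the congruence lemmas · §5
the item texts `IcosahedralABC`, `OctahedralABC` (inline) with the `Iff.rfl` bridges and `Assembly7` · §13
`belyi6_identity`, `belyi6_branch` (T_ico existence half: the degree-6 Belyi identity). The transport `octa_core` and
the frame lemma `exists_frame` of §4 sit (private) next to their consumer `closes7` in part 3.

Landing form: MECHANICAL six-module split of the source (full account in part 1/6 `PlatonicClosureCoreTransport`): namespace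
`Summit.ABC.ABC.Theorems.PlatonicClosureCore`, docstrings, imports, `private` copies of landed folklore lemmas; statements and proofs
byte-identical; imports NO route file (route `closes` may cite it by defeq of the §T tree texts).  Proves neither `ABC` nor any item.
-/

set_option linter.dupNamespace false
-- lint debt, justified: verbatim planner-cleared proofs keep the item texts' binder names (some hypotheses are unused by name).
set_option linter.unusedVariables false

open Literature.NumberTheory.DiophantineGeometry
open UniqueFactorizationMonoid
open Finset

namespace Summit.ABC.ABC.Theorems.PlatonicClosureCore

/-! ## §4  The octahedral transport (Klein's syzygy `T² + 108 f⁴ = H³`, degree 24)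

`f = xy(x⁴ - y⁴)` (6 vertices of the octahedron), `H = x⁸ + 14x⁴y⁴ + y⁸` (8 faces),
`T = x¹² - 33x⁸y⁴ - 33x⁴y⁸ + y¹²` (12 edges), `H³ - T² = 108 f⁴` (Klein 1884).  The special points
`0, ∞, ±1` are RATIONAL VERTICES: substituting a frame `(x,y)` of an abc triple with `x·y·(x±y) ⊇ {a,b,c}`
maps EVERY abc triple to a coprime triple `(T², 108 f⁴, H³)` of profile `≥ (2,4,3)` with
`c²⁴ ≤ 2²⁴·H³` and `rad ≤ 470016 · rad(abc) · c²³` — a quality-preserving transport INTO the octahedral level. -/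

/-- Klein's edge form of the octahedron. -/
def tO (x y : ℤ) : ℤ := x ^ 12 - 33 * x ^ 8 * y ^ 4 - 33 * x ^ 4 * y ^ 8 + y ^ 12

/-- Klein's octahedral syzygy `tO² + 108·f⁴ = H³` with `f = xy(x⁴ - y⁴)`, `H = x⁸ + 14x⁴y⁴ + y⁸`, as a polynomial
identity over `ℤ`. -/
theorem klein_octahedral (x y : ℤ) :
    tO x y ^ 2 + 108 * (x * y * (x ^ 4 - y ^ 4)) ^ 4 = (x ^ 8 + 14 * x ^ 4 * y ^ 4 + y ^ 8) ^ 3 := by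
  unfold tO; ring

/-- `tO x y` is odd when `x + y` is odd (computation in `ZMod 2`). -/
private theorem tO_mod_two : ∀ u v : ZMod 2, u + v = 1 →
    u ^ 12 - 33 * u ^ 8 * v ^ 4 - 33 * u ^ 4 * v ^ 8 + v ^ 12 ≠ 0 := by decide

/-- `3 ∤ tO x y` unless `3` divides both `x` and `y` (computation in `ZMod 3`). -/
private theorem tO_mod_three : ∀ u v : ZMod 3, ¬ (u = 0 ∧ v = 0) →
    u ^ 12 - 33 * u ^ 8 * v ^ 4 - 33 * u ^ 4 * v ^ 8 + v ^ 12 ≠ 0 := by decide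

/-- `3 ∣ xy(x⁴ - y⁴)` always (computation in `ZMod 3`). -/
private theorem f_mod_three : ∀ u v : ZMod 3, u * v * (u ^ 4 - v ^ 4) = 0 := by decide

/-! ## §5  The items of the gen-7 node (texts inlined, helper-free, exactly as to be filed) -/

/-- crux · **P_I IcosahedralABC** (NEW; tag UNDECIDED-with-test): abc, `ε`-uniform, on the ICOSAHEDRAL CELL — spherical
abc triples admitting multiplicities all `≥ 2`, two of them `≥ 3`, one of them `≥ 5` (profile exactly `(2,3,5)` up to
order: a squareful, a cube-full and a `5`-full member; populated: `10² + 3⁵ = 7³`).  The only multiplicity level of door J's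
residual that NO binary-form transport over `ℚ` with three rational special points reaches at the Riemann–Hurwitz-minimal
degree 60 (Klein's icosahedral map has no such `ℚ`-model); population `≍ B^{1/30}`. -/
def IcosahedralABC : Prop :=
  ∀ ε : ℝ, 0 < ε → ∃ C : ℝ, 0 < C ∧ ∀ a b c : ℕ, IsABCTriple a b c →
    ((∀ p q r : ℕ, ((p = 0 → a = 1) ∧ ∀ ℓ ∈ a.primeFactors, p ≤ a.factorization ℓ) →
        ((q = 0 → b = 1) ∧ ∀ ℓ ∈ b.primeFactors, q ≤ b.factorization ℓ) →
        ((r = 0 → c = 1) ∧ ∀ ℓ ∈ c.primeFactors, r ≤ c.factorization ℓ) →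
        1 < (p : ℚ)⁻¹ + (q : ℚ)⁻¹ + (r : ℚ)⁻¹) ∧
      (∃ p q r : ℕ, ((p = 0 → a = 1) ∧ ∀ ℓ ∈ a.primeFactors, p ≤ a.factorization ℓ) ∧
        ((q = 0 → b = 1) ∧ ∀ ℓ ∈ b.primeFactors, q ≤ b.factorization ℓ) ∧
        ((r = 0 → c = 1) ∧ ∀ ℓ ∈ c.primeFactors, r ≤ c.factorization ℓ) ∧
        (2 ≤ p ∧ 2 ≤ q ∧ 2 ≤ r ∧ (3 ≤ p ∧ 3 ≤ q ∨ 3 ≤ q ∧ 3 ≤ r ∨ 3 ≤ r ∧ 3 ≤ p) ∧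
          (5 ≤ p ∨ 5 ≤ q ∨ 5 ≤ r)))) →
    (c : ℝ) < C * ((rad a b c : ℕ) : ℝ) ^ (1 + ε)

/-- crux · **P_O OctahedralABC** (NEW; DECLARED RESIDUAL, `≡ S` modulo `P_H, P_E, P_I` by `closes7`/`node_iff7`):
abc, `ε`-uniform, on the OCTAHEDRAL CELL — spherical abc triples admitting multiplicities all `≥ 2`, two `≥ 3`, one `≥ 4`,
but NOT (all `≥ 2`, two `≥ 3`, one `≥ 5`) (profile exactly `(2,3,4)` up to order; population `≍ B^{1/12}`; populated by the
octahedral image of `1 + 1 = 2`: `4879² + 108·30⁴ = 481³`).  LOADED: Klein's octahedral syzygy maps every abc triple into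
this cell or into `Hyp ∪ Euc ∪ Ico` (kernel `octa_core`, `closes7`). -/
def OctahedralABC : Prop :=
  ∀ ε : ℝ, 0 < ε → ∃ C : ℝ, 0 < C ∧ ∀ a b c : ℕ, IsABCTriple a b c →
    ((∀ p q r : ℕ, ((p = 0 → a = 1) ∧ ∀ ℓ ∈ a.primeFactors, p ≤ a.factorization ℓ) →
        ((q = 0 → b = 1) ∧ ∀ ℓ ∈ b.primeFactors, q ≤ b.factorization ℓ) →
        ((r = 0 → c = 1) ∧ ∀ ℓ ∈ c.primeFactors, r ≤ c.factorization ℓ) →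
        1 < (p : ℚ)⁻¹ + (q : ℚ)⁻¹ + (r : ℚ)⁻¹) ∧
      (∃ p q r : ℕ, ((p = 0 → a = 1) ∧ ∀ ℓ ∈ a.primeFactors, p ≤ a.factorization ℓ) ∧
        ((q = 0 → b = 1) ∧ ∀ ℓ ∈ b.primeFactors, q ≤ b.factorization ℓ) ∧
        ((r = 0 → c = 1) ∧ ∀ ℓ ∈ c.primeFactors, r ≤ c.factorization ℓ) ∧
        (2 ≤ p ∧ 2 ≤ q ∧ 2 ≤ r ∧ (3 ≤ p ∧ 3 ≤ q ∨ 3 ≤ q ∧ 3 ≤ r ∨ 3 ≤ r ∧ 3 ≤ p) ∧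
          (4 ≤ p ∨ 4 ≤ q ∨ 4 ≤ r))) ∧
      ¬ (∃ p q r : ℕ, ((p = 0 → a = 1) ∧ ∀ ℓ ∈ a.primeFactors, p ≤ a.factorization ℓ) ∧
        ((q = 0 → b = 1) ∧ ∀ ℓ ∈ b.primeFactors, q ≤ b.factorization ℓ) ∧
        ((r = 0 → c = 1) ∧ ∀ ℓ ∈ c.primeFactors, r ≤ c.factorization ℓ) ∧
        (2 ≤ p ∧ 2 ≤ q ∧ 2 ≤ r ∧ (3 ≤ p ∧ 3 ≤ q ∨ 3 ≤ q ∧ 3 ≤ r ∨ 3 ≤ r ∧ 3 ≤ p) ∧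
          (5 ≤ p ∨ 5 ≤ q ∨ 5 ≤ r)))) →
    (c : ℝ) < C * ((rad a b c : ℕ) : ℝ) ^ (1 + ε)

/-- Bridge (`Iff.rfl`): the item text `IcosahedralABC` is abc on `IcoCell`. -/
theorem icosahedralABC_iff : IcosahedralABC ↔ AbcOn IcoCell := Iff.rfl
/-- Bridge (`Iff.rfl`): the item text `OctahedralABC` is abc on `OctCell`. -/
theorem octahedralABC_iff : OctahedralABC ↔ AbcOn OctCell := Iff.rfl
/-- Bridge (`Iff.rfl`): `EuclideanABC` (door J's tree text, inlined in §T) is abc on `EucShape`. -/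
theorem euclideanABC_iff : EuclideanABC ↔ AbcOn EucShape := Iff.rfl
/-- Bridge (`Iff.rfl`): `SphericalABC` (door J's tree text, inlined in §T) is abc on `SphType`. -/
theorem sphericalABC_iff : SphericalABC ↔ AbcOn SphType := Iff.rfl

/-- gen-7 assembly: `P_H → P_E → P_I → P_O → ABC`. -/
def Assembly7 : Prop :=
  CampanaHyperbolicBound → EuclideanABC → IcosahedralABC → OctahedralABC → _root_.ABC

/-! ## §13  T_ico, existence half (cycle-2 by-product): an icosahedral-profile Belyi map of degree 72 DEFINED OVER ℚ

`β₇₂ := R₆ ∘ π`, `R₆(u) = (125/864)(u² + u + 1/20)³/u⁵`, `π(t) = (t¹² − 11t⁶ − 1)/(250 t⁶)` (the `D₆`-orbifold quotient, branch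
values `u = ∞` of order 6 and `u = (−11 ± 2i)/250` of order 2 = the two SIMPLE points of `R₆` over 1).  Passport of `β₇₂`:
`[6² 5¹²]_∞ [3²⁴]_0 [2³⁶]_1` (fullerene-`C₂₄` type), so the FLOORS (2,3,5) of the icosahedral cell hold with `deg = 72 > 60`:
floored dessins over ℚ beyond Klein's `A₅`-quotient EXIST.  The kernel certifies the one algebraic fact this rests on — the
degree-6 Belyi identity (cleared of denominators); the `D₆`-twist census showing that every ℚ-model of THIS dessin still has at
most two rational special points (so it does not load `IcosahedralABC`) is in NODE-g7.md §3b / tico/beta72_certificate.txt. -/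

/-- the degree-6 Belyi identity behind `β₇₂`: `125(20u²+20u+1)³ − 6912000·u⁵ = 125(4u²−8u−1)²(500u²+44u+1)`,
i.e. `R₆ − 1 = (125/864)(u²−2u−1/4)²(u²+(11/125)u+1/500)/u⁵`. -/
theorem belyi6_identity (u : ℤ) :
    125 * (20 * u ^ 2 + 20 * u + 1) ^ 3 - 6912000 * u ^ 5 =
      125 * (4 * u ^ 2 - 8 * u - 1) ^ 2 * (500 * u ^ 2 + 44 * u + 1) := by
  ring

/-- the two simple points of `R₆` over 1 are the critical values of `π`: `500u² + 44u + 1 = 0 ⟺ u = (−11 ± 2i)/250`, and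
`π(t) = u ⟺ T² − (11 + 250u)T − 1 = 0` (`T = t⁶`) has a double root iff `(11 + 250u)² = −4`; both say `(250u + 11)² + 4 = 0`: -/
theorem belyi6_branch (u : ℤ) : 125 * (500 * u ^ 2 + 44 * u + 1) = ((250 * u + 11) ^ 2 + 4) := by
  ring

end Summit.ABC.ABC.Theorems.PlatonicClosureCore
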